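import Literature.AlgebraicGeometry.HodgeTheory.HodgeGroupProductCMFactor
import Literature.AlgebraicGeometry.HodgeTheory.AbelJacobiPullbackHodgeSection
import HarnessLib

/-!
# A criterion for `HodgeClassesProductSpan`: Hodge classes in the span of (rational Hodge classes of `B`) ⊠ (classes of pure type of `Z`) are spanned by exterior products of rational Hodge classes (Künneth uniqueness + rationality of Künneth coefficients + the type projectors; Hatcher Thm. 3.16, Voisin I §7.1.1 / §11.3)

Family `hodge`, layer `Literature/AlgebraicGeometry/HodgeTheory`. Research context: cell `pub-hodge-ring2`
(HONEST FRAMING: research route conditional on HC_CM; not a corollary; Q11.4-sentence-2 already refuted in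
dim ≥ 3), Literature lane, programme R4 («RM × CM»). UNCONDITIONAL; theorems only, no named fact; no step
towards a summit statement.

THE CRITERION `mem_span_hodgeProductClasses_of_mem_span_typed`. Let `B`, `Z` be complex abelian varieties and
`c ∈ H^{2p}((B × Z)(ℂ); ℂ)` a RATIONAL class of Hodge type `(p,p)` lying in the `ℂ`-span of the classes
`pr_B^* d ⌣ pr_Z^* μ` with `d` in the `ℂ`-span of the rational `(l,l)`-classes of `B` (e.g. `d ∈ D^l(B) ⊗ ℂ`)
and `μ` of some pure type `(r₀, r₁)` on `Z` (e.g. a monomial in Hodge-adapted degree-one classes). Then `c` lies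
in the span of `hodgeProductClasses B Z p` (exterior products of RATIONAL Hodge classes of `B` and of `Z`).
This is the linear algebra turning «the invariants of `H(B) × H(Z)` are (Hodge classes of `B`) ⊗
(cohomology of `Z`)» into Moonen–Zarhin's «`B(B × Z)` is generated by `B(B)` and `B(Z)`» (1999, §3 (3.1)).

PROOF. (1) The type projector `π_{(p,p)}` of `B × Z` kills `pr_B^* d ⌣ pr_Z^* μ` unless `μ` is balanced
(`r₀ = r₁`), since types add under exterior products (Voisin I Thm. 11.38, the tree's `CupPreservesHodgeType`
from de Rham's theorem) — so `c = π c` lies in the span of the balanced products. (2) Expand along the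
Künneth decomposition with RATIONAL bases `ζ` of `H^•(Z)` (Hatcher Thm. 3.16, the tree's
`complexBetti_kunneth_bijective`): `c = Σ_J pr_B^* a_J ⌣ pr_Z^* ζ_J` with UNIQUE `a_J`; the `a_J` are rational
(`isRationalClass_kunneth_symm_apply`, rational classes have rational coordinates along rational bases) and
lie in the span of the rational `(l,l)`-classes (the Künneth coefficients of a generator `pr_B^* d ⌣ pr_Z^* μ`
are multiples of `d`, `kunneth_symm_cupProduct_eq_sum`). (3) Choose, degree by degree, `ℂ`-independent rational
Hodge classes `e` spanning these spans; the coordinates of the `a_J` along them are rational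
(`IsRationalClass.coeff_mem_range_of_linearIndependent`), so `c = Σ_e pr_B^* e ⌣ pr_Z^* w_e` with RATIONAL
`w_e`; applying `π_{(p,p)}` (which acts on `pr_B^* e ⌣ pr_Z^* w` through the type projector of `Z`,
`typeProj_cupProduct_map_fst_map_snd`) and reading Künneth coefficients again shows `w_e = π_Z w_e`, i.e. every
`w_e` is of type `(k,k)`: a rational Hodge class of `Z`.

## References

* [HatcherAT2002] A. Hatcher, *Algebraic Topology* (2002), §3.2 Thm. 3.16. [cite: HatcherAT2002, §3.2 Thm. 3.16]
* [VoisinHodgeI2002] C. Voisin, *Hodge Theory I*, §7.1.1, Thm. 6.18, §11.3.2 Thm. 11.38. [cite: VoisinHodgeI2002, §11.3.2 Thm. 11.38]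
* [MoonenZarhin1999LowDim] B. Moonen, Yu. Zarhin, Math. Ann. 315 (1999), §3 (3.1). [cite: MoonenZarhin1999LowDim, §3 (3.1)]
-/

noncomputable section

open CategoryTheory MonoidalCategory CartesianMonoidalCategory
open Literature.AlgebraicTopology.SingularHomology
open Literature.AlgebraicGeometry.Motives

namespace Literature.AlgebraicGeometry.HodgeTheory

/-! ### §1 Künneth coefficients: of a product `pr_B^* y ⌣ pr_Z^* v`, and rationality -/

section KunnethCoeff

variable {m n : ℕ} {Y Z : SchemeOver ℂ} {σ : Fin (2 * n + 1) → Type} [∀ j, Fintype (σ j)]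

/-- **The Künneth coefficients of `pr₁^* y ⌣ pr₂^* v`**: along the basis `pr₂^* b_J`, the class
`pr₁^* y ⌣ pr₂^* v` (`y ∈ H^{k-j}(Y)`, `v ∈ Hʲ(Z)`) has coefficient `v_i · y` at `J = (j, i)` (`v_i` the
coordinates of `v` in `b j`) and `0` at the other indices: `θ⁻¹(pr₁^* y ⌣ pr₂^* v) = Σ_i v_i δ_{(j,i)} y`.
[cite: HatcherAT2002, §3.2 Thm. 3.16] -/
theorem kunneth_symm_cupProduct_eq_sum [DecidableEq (Σ j, σ j)] (hY : IsSmoothProjective m Y)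
    (hZ : IsSmoothProjective n Z) (b : (j : Fin (2 * n + 1)) → Module.Basis (σ j) ℂ (complexBetti Z j)) (k : ℕ)
    {j : Fin (2 * n + 1)} (hj : (j : ℕ) ≤ k) (y : complexBetti Y (k - j)) (v : complexBetti Z j) :
    (LinearEquiv.ofBijective _ (complexBetti_kunneth_bijective hY hZ b k)).symm
        (cupProduct (Nat.sub_add_cancel hj) (complexBetti.map (fst Y Z) (k - j) y)
          (complexBetti.map (snd Y Z) j v)) =
      ∑ i : σ j, (b j).repr v i •
        (Pi.single (⟨⟨j, i⟩, hj⟩ : LerayHirsch.Idx (fun J : (Σ j, σ j) ↦ (J.1 : ℕ)) k) y :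
          LerayHirsch.Src ℂ (fun J : (Σ j, σ j) ↦ (J.1 : ℕ)) (ComplexPoints Y) k) := by
  set E := LinearEquiv.ofBijective _ (complexBetti_kunneth_bijective hY hZ b k) with hE
  apply E.injective
  rw [E.apply_symm_apply, map_sum]
  have hsingle : ∀ i : σ j, E (Pi.single (⟨⟨j, i⟩, hj⟩ : LerayHirsch.Idx (fun J : (Σ j, σ j) ↦ (J.1 : ℕ)) k) y) =
      cupProduct (Nat.sub_add_cancel hj) (complexBetti.map (fst Y Z) (k - j) y)
        (complexBetti.map (snd Y Z) j (b j i)) := fun i => by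
    rw [hE, LinearEquiv.ofBijective_apply, LerayHirsch.lhMap_single]
  simp only [map_smul, hsingle]
  conv_lhs => rw [← (b j).sum_repr v]
  rw [map_sum, map_sum]
  refine Finset.sum_congr rfl fun i _ => ?_
  rw [map_smul, map_smul]

/-- Hence: the Künneth coefficient of `pr₁^* y ⌣ pr₂^* v` (`v ∈ H^{j₀}(Z)`, `j₀` the degree of the index `J`)
at `J = (j₀, i₀)` is `v_{i₀} · y`. [cite: HatcherAT2002, §3.2 Thm. 3.16] -/
theorem kunneth_symm_cupProduct_apply_self [DecidableEq (Σ j, σ j)] (hY : IsSmoothProjective m Y)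
    (hZ : IsSmoothProjective n Z) (b : (j : Fin (2 * n + 1)) → Module.Basis (σ j) ℂ (complexBetti Z j)) (k : ℕ)
    (J : LerayHirsch.Idx (fun J : (Σ j, σ j) ↦ (J.1 : ℕ)) k) (y : complexBetti Y (k - J.1.1))
    (v : complexBetti Z J.1.1) :
    (LinearEquiv.ofBijective _ (complexBetti_kunneth_bijective hY hZ b k)).symm
        (cupProduct (Nat.sub_add_cancel J.2) (complexBetti.map (fst Y Z) (k - J.1.1) y)
          (complexBetti.map (snd Y Z) J.1.1 v)) J = (b J.1.1).repr v J.1.2 • y := by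
  obtain ⟨⟨j₀, i₀⟩, hJ⟩ := J
  rw [kunneth_symm_cupProduct_eq_sum hY hZ b k hJ y v, Finset.sum_apply, Finset.sum_eq_single i₀]
  · rw [Pi.smul_apply, Pi.single_eq_same]
  · intro i _ hi
    rw [Pi.smul_apply, Pi.single_eq_of_ne, smul_zero]
    intro h
    apply hi
    simp only [Subtype.mk.injEq, Sigma.mk.inj_iff, heq_eq_eq, true_and] at h
    exact h.symm
  · exact fun h => absurd (Finset.mem_univ _) h

/-- And the Künneth coefficient of `pr₁^* y ⌣ pr₂^* v` (`v ∈ Hʲ(Z)`) at an index `J` of degree `≠ j` vanishes.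
[cite: HatcherAT2002, §3.2 Thm. 3.16] -/
theorem kunneth_symm_cupProduct_apply_of_ne [DecidableEq (Σ j, σ j)] (hY : IsSmoothProjective m Y)
    (hZ : IsSmoothProjective n Z) (b : (j : Fin (2 * n + 1)) → Module.Basis (σ j) ℂ (complexBetti Z j)) (k : ℕ)
    (J : LerayHirsch.Idx (fun J : (Σ j, σ j) ↦ (J.1 : ℕ)) k) {j : Fin (2 * n + 1)} (hj : (j : ℕ) ≤ k)
    (hne : J.1.1 ≠ j) (y : complexBetti Y (k - j)) (v : complexBetti Z j) :
    (LinearEquiv.ofBijective _ (complexBetti_kunneth_bijective hY hZ b k)).symm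
        (cupProduct (Nat.sub_add_cancel hj) (complexBetti.map (fst Y Z) (k - j) y)
          (complexBetti.map (snd Y Z) j v)) J = 0 := by
  rw [kunneth_symm_cupProduct_eq_sum hY hZ b k hj y v, Finset.sum_apply]
  refine Finset.sum_eq_zero fun i _ => ?_
  rw [Pi.smul_apply, Pi.single_eq_of_ne, smul_zero]
  intro h
  apply hne
  rw [h]

/-- **The Künneth coefficients of a rational class along rational bases are rational** (the
`pr₁^* y_l ⌣ pr₂^* b_J`, `y_l` rational bases of the `Hⁱ(Y)`, form a `ℂ`-basis of `Hᵏ(Y × Z)` of rational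
classes, along which a rational class has rational coordinates). The argument is the one inside the tree's
`kunnethSection_isRationalClass`. [cite: HatcherAT2002, §3.2 Thm. 3.16 and §3.1 p. 198] [cite: VoisinHodgeI2002, §7.1.1] -/
theorem isRationalClass_kunneth_symm_apply (hY : IsSmoothProjective m Y) (hZ : IsSmoothProjective n Z)
    (b : (j : Fin (2 * n + 1)) → Module.Basis (σ j) ℂ (complexBetti Z j)) (hb : ∀ j i, IsRationalClass (b j i))
    (k : ℕ) {z : complexBetti (Y ⊗ Z) k} (hz : IsRationalClass z)
    (J : LerayHirsch.Idx (fun J : (Σ j, σ j) ↦ (J.1 : ℕ)) k) :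
    IsRationalClass ((LinearEquiv.ofBijective _ (complexBetti_kunneth_bijective hY hZ b k)).symm z J) := by
  classical
  obtain ⟨a, rfl⟩ := (complexBetti_kunneth_bijective hY hZ b k).2 z
  set E := LinearEquiv.ofBijective _ (complexBetti_kunneth_bijective hY hZ b k) with hE
  have hEa : E.symm (LerayHirsch.lhMap ℂ (fun J : (Σ j, σ j) ↦ (J.1 : ℕ))
      (AlgPoints.mapContinuous (L := ℂ) (fst Y Z)) (fun J ↦ complexBetti.map (snd Y Z) J.1 (b J.1 J.2)) k a) = a :=
    E.symm_apply_apply a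
  rw [hEa]
  choose r bY hbY using fun i ↦ exists_basis_isRationalClass hY i
  let P : Module.Basis (Σ J : LerayHirsch.Idx (fun J : (Σ j, σ j) ↦ (J.1 : ℕ)) k, Fin (r (k - (J.1.1 : ℕ)))) ℂ
      (LerayHirsch.Src ℂ (fun J : (Σ j, σ j) ↦ (J.1 : ℕ)) (ComplexPoints Y) k) :=
    Pi.basis fun J ↦ bY (k - (J.1.1 : ℕ))
  let v := P.map E
  have hv : ∀ Jl, IsRationalClass (v Jl) := by
    rintro ⟨J', l⟩
    change IsRationalClass (E (P ⟨J', l⟩))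
    rw [Pi.basis_apply]
    change IsRationalClass (LerayHirsch.lhMap ℂ (fun J : (Σ j, σ j) ↦ (J.1 : ℕ))
      (AlgPoints.mapContinuous (L := ℂ) (fst Y Z))
      (fun J ↦ complexBetti.map (snd Y Z) J.1 (b J.1 J.2)) k (Pi.single J' (bY _ l)))
    rw [LerayHirsch.lhMap_single]
    exact ((hbY _ l).map _).cup _ ((hb _ _).map _)
  have hrepr : ∀ Jl, v.repr (E a) Jl = P.repr a Jl := fun Jl ↦ by
    rw [Module.Basis.map_repr, LinearEquiv.trans_apply, E.symm_apply_apply]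
  have hexp : E a = ∑ Jl, (v.repr (E a) Jl) • v Jl := (v.sum_repr (E a)).symm
  have hz' : IsRationalClass (∑ Jl, (v.repr (E a) Jl) • v Jl) := by rw [← hexp]; exact hz
  have hcoef : ∀ Jl, v.repr (E a) Jl ∈ Set.range (algebraMap ℚ ℂ) := fun Jl ↦
    IsRationalClass.coeff_mem_range_of_linearIndependent hv v.linearIndependent hz' Jl
  have haJ : a J = ∑ l, (P.repr a ⟨J, l⟩) • bY (k - (J.1.1 : ℕ)) l := by
    conv_lhs => rw [← (bY (k - (J.1.1 : ℕ))).sum_repr (a J)]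
    refine Finset.sum_congr rfl fun l _ ↦ ?_
    rw [Pi.basis_repr]
  choose q hq using fun l ↦ hcoef ⟨J, l⟩
  have haJ' : a J = ∑ l, ((q l : ℚ) : ℂ) • bY (k - (J.1.1 : ℕ)) l := by
    rw [haJ]
    refine Finset.sum_congr rfl fun l _ ↦ ?_
    rw [← hrepr, ← hq l]
    rfl
  rw [haJ']
  exact IsRationalClass.sum_smul _ (fun l ↦ hbY _ l) q

/-- Sums over the Künneth index set `{J = (j, i) : j ≤ k}` as iterated sums over `j` and `i`. [folklore] -/
private theorem sum_idx_eq_sum_sum_dite {M : Type*} [AddCommMonoid M] (k : ℕ)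
    (G : LerayHirsch.Idx (fun J : (Σ j, σ j) ↦ (J.1 : ℕ)) k → M) :
    ∑ J, G J = ∑ j : Fin (2 * n + 1), ∑ i : σ j,
      if h : (j : ℕ) ≤ k then G ⟨⟨j, i⟩, h⟩ else 0 := by
  classical
  set f : (Σ j, σ j) → M := fun J₀ => if h : (J₀.1 : ℕ) ≤ k then G ⟨J₀, h⟩ else 0 with hf
  have h1 : ∑ J, G J = ∑ J : LerayHirsch.Idx (fun J : (Σ j, σ j) ↦ (J.1 : ℕ)) k, f J.1 := by
    refine Finset.sum_congr rfl fun J _ => ?_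
    rw [hf]
    simp only [dif_pos J.2]
  rw [h1, ← Finset.sum_subtype (Finset.univ.filter fun J₀ : (Σ j, σ j) => (J₀.1 : ℕ) ≤ k)
    (fun J₀ => by simp) f, Finset.sum_filter]
  have h2 : ∑ a : (Σ j, σ j), (if (a.1 : ℕ) ≤ k then f a else 0) = ∑ a : (Σ j, σ j), f a :=
    Finset.sum_congr rfl fun a _ => by
      by_cases h : (a.1 : ℕ) ≤ k
      · rw [if_pos h]
      · rw [if_neg h, hf]
        simp only [dif_neg h]
  rw [h2, Fintype.sum_sigma]

end KunnethCoeff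

/-! ### §2 The type projector of `B × Z` on `pr_B^* e ⌣ pr_Z^* w` with `e` of pure type -/

section Projector

variable {m n : ℕ} {Y Z : SchemeOver ℂ}

/-- **`π_{(P,Q)}(pr₁^* e ⌣ pr₂^* w) = pr₁^* e ⌣ pr₂^* π_{(P-l, Q-l')} w` for `e` of pure type `(l, l')`**:
decompose `w` into its type components (`sum_typeProj`); types add under exterior products (Voisin I
Thm. 11.38, the tree's `CupPreservesHodgeType` for `Y × Z` from de Rham's theorem), so exactly the component
of type `(P-l, Q-l')` survives the projector (uniqueness of the type decomposition, `typeProj_apply_of_mem(_ne)`).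
[cite: VoisinHodgeI2002, Thm. 6.18 and §11.3.2 Thm. 11.38] -/
theorem typeProj_cupProduct_map_fst_map_snd (hY : IsSmoothProjective m Y) (hZ : IsSmoothProjective n Z)
    (MX : HodgeModel (m + n) (Y ⊗ Z)) (MZ : HodgeModel n Z) {i j s : ℕ} (hij : i + j = s) {l l' : ℕ}
    (hl : l + l' = i) {e : complexBetti Y i} (he : IsOfHodgeType m Y i l l' e) (w : complexBetti Z j)
    {k k' : ℕ} (hk : k + k' = j) {P Q : ℕ} (hPQ : P + Q = s) (hP : l + k = P) (hQ : l' + k' = Q) :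
    MX.typeProj s ⟨(P, Q), Finset.HasAntidiagonal.mem_antidiagonal.2 hPQ⟩
        (cupProduct hij (complexBetti.map (fst Y Z) i e) (complexBetti.map (snd Y Z) j w)) =
      cupProduct hij (complexBetti.map (fst Y Z) i e)
        (complexBetti.map (snd Y Z) j (MZ.typeProj j ⟨(k, k'), Finset.HasAntidiagonal.mem_antidiagonal.2 hk⟩ w)) := by
  classical
  have hX : IsSmoothProjective (m + n) (Y ⊗ Z) := IsSmoothProjective.tensor_holds hY hZ
  have hI : hodgePQ_independent_of_hodgeModel := hodgePQ_independent_of_hodgeModel_holds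
  have hcup : CupPreservesHodgeType (m + n) (Y ⊗ Z) :=
    cupPreservesHodgeType_of_multiplicative_deRham
      (fun E _ _ _ ↦ Literature.NumberTheory.Transcendental.exists_deRhamIsoFamily_holds E) hX
  -- the type of `pr₁^* e ⌣ pr₂^* π_rs w` is `(l + r, l' + s')`
  have htyp : ∀ rs : ↥(Finset.HasAntidiagonal.antidiagonal j), cupProduct hij (complexBetti.map (fst Y Z) i e)
      (complexBetti.map (snd Y Z) j (MZ.typeProj j rs w)) ∈
      MX.typePiece s ⟨(l + rs.1.1, l' + rs.1.2), Finset.HasAntidiagonal.mem_antidiagonal.2 (by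
        have h1 := Finset.HasAntidiagonal.mem_antidiagonal.1 rs.2; omega)⟩ := fun rs =>
    MX.mem_typePiece_of_isOfHodgeType hI hX _
      (hcup hij (he.map_of_isSmoothProjective hX hY (fst Y Z))
        ((MZ.isOfHodgeType_of_mem_typePiece (MZ.typeProj_mem j rs w)).map_of_isSmoothProjective hX hZ (snd Y Z)))
  conv_lhs => rw [← MZ.sum_typeProj j w]
  rw [map_sum, map_sum, map_sum,
    Finset.sum_eq_single (⟨(k, k'), Finset.HasAntidiagonal.mem_antidiagonal.2 hk⟩ : ↥(Finset.HasAntidiagonal.antidiagonal j))]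
  · -- the surviving component
    have hmem := htyp ⟨(k, k'), Finset.HasAntidiagonal.mem_antidiagonal.2 hk⟩
    have hidx : (⟨(l + k, l' + k'), Finset.HasAntidiagonal.mem_antidiagonal.2 (by omega)⟩ : ↥(Finset.HasAntidiagonal.antidiagonal s)) =
        ⟨(P, Q), Finset.HasAntidiagonal.mem_antidiagonal.2 hPQ⟩ := Subtype.ext (Prod.ext hP hQ)
    rw [hidx] at hmem
    exact MX.typeProj_apply_of_mem hmem
  · intro rs _ hrs
    refine MX.typeProj_apply_of_mem_ne (fun heq => hrs ?_) (htyp rs)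
    have h1 := congrArg (fun x : ↥(Finset.HasAntidiagonal.antidiagonal s) => x.1) heq
    simp only [Prod.mk.injEq] at h1
    exact Subtype.ext (Prod.ext (by simp only; omega) (by simp only; omega))
  · exact fun h => absurd (Finset.mem_univ _) h

end Projector

/-! ### §3 The criterion -/

section Criterion

/-- Membership in `hodgeProductClasses` from data in degrees `i + j = 2p` (degrees substituted).
[cite: MoonenZarhin1999LowDim, §3 (3.1)] -/
private theorem cupProduct_mem_hodgeProductClasses (B Z : AbelianVariety ℂ) {p i j : ℕ} (hij : i + j = 2 * p)
    {l k : ℕ} (hl : 2 * l = i) (hk : 2 * k = j) {a : complexBetti B.X i} {b : complexBetti Z.X j}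
    (ha : IsRationalClass a) (ha' : IsOfHodgeType B.dim B.X i l l a) (hb : IsRationalClass b)
    (hb' : IsOfHodgeType Z.dim Z.X j k k b) :
    cupProduct hij (complexBetti.map (fst B.X Z.X) i a) (complexBetti.map (snd B.X Z.X) j b) ∈
      hodgeProductClasses B Z p := by
  subst hl
  subst hk
  exact ⟨l, k, hij, a, b, ha, ha', hb, hb', rfl⟩

set_option maxHeartbeats 800000 in
/-- **THE CRITERION.** For complex abelian varieties `B`, `Z` and a RATIONAL class `c` of Hodge type `(p,p)` on
`B × Z` lying in the `ℂ`-span of the classes `pr_B^* d ⌣ pr_Z^* μ` with `d` in the `ℂ`-span of the rational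
`(l,l)`-classes of `B` (`2l = deg d`) and `μ` of some pure type `(r₀,r₁)` on `Z`: `c` is a `ℂ`-combination of
exterior products of rational Hodge classes of `B` and of `Z` (`hodgeProductClasses B Z p`). Künneth
uniqueness (Hatcher Thm. 3.16), rationality of Künneth coefficients, and the type projectors (Voisin I Thm. 6.18,
Thm. 11.38); this is the passage from «invariants of `H(B) × H(Z)`» to Moonen–Zarhin's «`B(B × Z)` is generated
by `B(B)` and `B(Z)`». [cite: MoonenZarhin1999LowDim, §3 (3.1)] [cite: HatcherAT2002, §3.2 Thm. 3.16]
[cite: VoisinHodgeI2002, Thm. 6.18 and §11.3.2 Thm. 11.38] -/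
theorem mem_span_hodgeProductClasses_of_mem_span_typed (B Z : AbelianVariety ℂ) {p : ℕ}
    {c : complexBetti (B.X ⊗ Z.X) (2 * p)} (hcQ : IsRationalClass c)
    (hc : IsOfHodgeType (B.dim + Z.dim) (B.X ⊗ Z.X) (2 * p) p p c)
    (hmem : c ∈ Submodule.span ℂ {z : complexBetti (B.X ⊗ Z.X) (2 * p) | ∃ (i j : ℕ) (hij : i + j = 2 * p)
      (d : complexBetti B.X i) (μ : complexBetti Z.X j),
      d ∈ Submodule.span ℂ {d' : complexBetti B.X i | IsRationalClass d' ∧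
        ∃ l, 2 * l = i ∧ IsOfHodgeType B.dim B.X i l l d'} ∧
      (∃ r₀ r₁, r₀ + r₁ = j ∧ IsOfHodgeType Z.dim Z.X j r₀ r₁ μ) ∧
      z = cupProduct hij (complexBetti.map (fst B.X Z.X) i d) (complexBetti.map (snd B.X Z.X) j μ)}) :
    c ∈ Submodule.span ℂ (hodgeProductClasses B Z p) := by
  classical
  -- the setting
  have hB : IsSmoothProjective B.dim B.X := AbelianVariety.isSmoothProjective_holds
  have hZ : IsSmoothProjective Z.dim Z.X := AbelianVariety.isSmoothProjective_holds
  have hX : IsSmoothProjective (B.dim + Z.dim) (B.X ⊗ Z.X) := IsSmoothProjective.tensor_holds hB hZ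
  have hI : hodgePQ_independent_of_hodgeModel := hodgePQ_independent_of_hodgeModel_holds
  obtain ⟨MZ⟩ := nonempty_hodgeModel_holds (n := Z.dim) (X := Z.X) hZ
  obtain ⟨MX⟩ := nonempty_hodgeModel_holds (n := B.dim + Z.dim) (X := B.X ⊗ Z.X) hX
  have hcup : CupPreservesHodgeType (B.dim + Z.dim) (B.X ⊗ Z.X) :=
    cupPreservesHodgeType_of_multiplicative_deRham
      (fun E _ _ _ ↦ Literature.NumberTheory.Transcendental.exists_deRhamIsoFamily_holds E) hX
  haveI := fun i ↦ finite_complexBetti hB i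
  haveI := fun j ↦ finite_complexBetti hZ j
  -- STEP 1: the type projector `π_{(p,p)}` keeps only the balanced products
  let pp : ↥(Finset.HasAntidiagonal.antidiagonal (2 * p)) :=
    ⟨(p, p), Finset.HasAntidiagonal.mem_antidiagonal.2 (by omega)⟩
  set π := MX.typeProj (2 * p) pp with hπ
  set S₁ : Set (complexBetti (B.X ⊗ Z.X) (2 * p)) := {z | ∃ (i j : ℕ) (hij : i + j = 2 * p)
      (d : complexBetti B.X i) (μ : complexBetti Z.X j) (l k : ℕ), 2 * l = i ∧ 2 * k = j ∧
      IsRationalClass d ∧ IsOfHodgeType B.dim B.X i l l d ∧ IsOfHodgeType Z.dim Z.X j k k μ ∧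
      z = cupProduct hij (complexBetti.map (fst B.X Z.X) i d) (complexBetti.map (snd B.X Z.X) j μ)} with hS₁
  have hπc : π c = c :=
    MX.typeProj_apply_of_mem (MX.mem_typePiece_of_isOfHodgeType hI hX pp.2 hc)
  have hstep1 : c ∈ Submodule.span ℂ S₁ := by
    rw [← hπc]
    have hle : Submodule.span ℂ {z : complexBetti (B.X ⊗ Z.X) (2 * p) | ∃ (i j : ℕ) (hij : i + j = 2 * p)
        (d : complexBetti B.X i) (μ : complexBetti Z.X j),
        d ∈ Submodule.span ℂ {d' : complexBetti B.X i | IsRationalClass d' ∧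
          ∃ l, 2 * l = i ∧ IsOfHodgeType B.dim B.X i l l d'} ∧
        (∃ r₀ r₁, r₀ + r₁ = j ∧ IsOfHodgeType Z.dim Z.X j r₀ r₁ μ) ∧
        z = cupProduct hij (complexBetti.map (fst B.X Z.X) i d) (complexBetti.map (snd B.X Z.X) j μ)} ≤
        (Submodule.span ℂ S₁).comap π := by
      refine Submodule.span_le.2 ?_
      rintro z ⟨i, j, hij, d, μ, hd, ⟨r₀, r₁, hr, hμ⟩, rfl⟩
      set Lμ : complexBetti B.X i →ₗ[ℂ] complexBetti (B.X ⊗ Z.X) (2 * p) :=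
        π ∘ₗ (cupProduct hij).flip (complexBetti.map (snd B.X Z.X) j μ) ∘ₗ (complexBetti.map (fst B.X Z.X) i).hom
        with hLμ
      have hLμ_apply : ∀ d', Lμ d' = π (cupProduct hij (complexBetti.map (fst B.X Z.X) i d')
          (complexBetti.map (snd B.X Z.X) j μ)) := fun d' => rfl
      change π (cupProduct hij (complexBetti.map (fst B.X Z.X) i d) (complexBetti.map (snd B.X Z.X) j μ)) ∈
        Submodule.span ℂ S₁
      rw [← hLμ_apply]
      have hle' : Submodule.span ℂ {d' : complexBetti B.X i | IsRationalClass d' ∧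
          ∃ l, 2 * l = i ∧ IsOfHodgeType B.dim B.X i l l d'} ≤ (Submodule.span ℂ S₁).comap Lμ := by
        refine Submodule.span_le.2 ?_
        rintro d' ⟨hd'Q, l, hl, hd'⟩
        change Lμ d' ∈ Submodule.span ℂ S₁
        rw [hLμ_apply]
        have htyp : IsOfHodgeType (B.dim + Z.dim) (B.X ⊗ Z.X) (2 * p) (l + r₀) (l + r₁)
            (cupProduct hij (complexBetti.map (fst B.X Z.X) i d') (complexBetti.map (snd B.X Z.X) j μ)) :=
          hcup hij (hd'.map_of_isSmoothProjective hX hB (fst B.X Z.X))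
            (hμ.map_of_isSmoothProjective hX hZ (snd B.X Z.X))
        have hanti : (l + r₀, l + r₁) ∈ Finset.HasAntidiagonal.antidiagonal (2 * p) :=
          Finset.HasAntidiagonal.mem_antidiagonal.2 (by omega)
        have hmemX := MX.mem_typePiece_of_isOfHodgeType hI hX hanti htyp
        by_cases heq : (⟨(l + r₀, l + r₁), hanti⟩ : ↥(Finset.HasAntidiagonal.antidiagonal (2 * p))) = pp
        · have h0 : r₀ = r₁ := by
            have h1 := congrArg (fun x : ↥(Finset.HasAntidiagonal.antidiagonal (2 * p)) => x.1) heq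
            simp only [pp, Prod.mk.injEq] at h1
            omega
          subst h0
          rw [heq] at hmemX
          rw [MX.typeProj_apply_of_mem hmemX]
          exact Submodule.subset_span ⟨i, j, hij, d', μ, l, r₀, hl, by omega, hd'Q, hd', hμ, rfl⟩
        · rw [MX.typeProj_apply_of_mem_ne heq hmemX]
          exact Submodule.zero_mem _
      exact hle' hd
    exact hle hmem
  -- STEP 2: Künneth coefficients along rational bases of `H^•(Z)`
  choose rZ ζ hζ using fun j : ℕ => exists_basis_isRationalClass hZ j
  let bZ : (j : Fin (2 * Z.dim + 1)) → Module.Basis (Fin (rZ j)) ℂ (complexBetti Z.X j) := fun j => ζ j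
  set E := LinearEquiv.ofBijective _ (complexBetti_kunneth_bijective hB hZ bZ (2 * p)) with hE
  set a : LerayHirsch.Src ℂ (fun J : (Σ j : Fin (2 * Z.dim + 1), Fin (rZ j)) ↦ (J.1 : ℕ))
    (ComplexPoints B.X) (2 * p) := E.symm c with ha
  have haQ : ∀ J, IsRationalClass (a J) := fun J =>
    isRationalClass_kunneth_symm_apply hB hZ bZ (fun j i => hζ j i) (2 * p) hcQ J
  -- the spans of rational Hodge classes, degree by degree
  set R : (jf : Fin (2 * Z.dim + 1)) → Set (complexBetti B.X (2 * p - jf)) := fun jf =>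
    {d' | IsRationalClass d' ∧ ∃ l, 2 * l = 2 * p - (jf : ℕ) ∧ IsOfHodgeType B.dim B.X (2 * p - jf) l l d'}
    with hR
  have haR : ∀ J, a J ∈ Submodule.span ℂ (R J.1.1) := by
    intro J
    have hle : Submodule.span ℂ S₁ ≤
        (Submodule.span ℂ (R J.1.1)).comap (LinearMap.proj J ∘ₗ E.symm.toLinearMap) := by
      refine Submodule.span_le.2 ?_
      rintro z ⟨i, j, hij, d, μ, l, k, hl, hk, hdQ, hd, hμ, rfl⟩
      change (E.symm (cupProduct hij (complexBetti.map (fst B.X Z.X) i d)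
        (complexBetti.map (snd B.X Z.X) j μ))) J ∈ Submodule.span ℂ (R J.1.1)
      obtain rfl : i = 2 * p - j := by omega
      by_cases hjn : j ≤ 2 * Z.dim
      · have hjp : j ≤ 2 * p := by omega
        let jf : Fin (2 * Z.dim + 1) := ⟨j, by omega⟩
        have hexp := kunneth_symm_cupProduct_eq_sum hB hZ bZ (2 * p) (j := jf) hjp d μ
        rw [hE, hexp, Finset.sum_apply]
        refine Submodule.sum_mem _ fun i _ => ?_
        rw [Pi.smul_apply]
        by_cases hJ : J = ⟨⟨jf, i⟩, hjp⟩
        · rw [hJ, Pi.single_eq_same]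
          exact Submodule.smul_mem _ _ (Submodule.subset_span ⟨hdQ, l, hl, hd⟩)
        · rw [Pi.single_eq_of_ne hJ, smul_zero]
          exact Submodule.zero_mem _
      · haveI := subsingleton_complexBetti hZ (show 2 * Z.dim < j by omega)
        rw [Subsingleton.elim μ 0, map_zero, map_zero, map_zero, Pi.zero_apply]
        exact Submodule.zero_mem _
    have h := hle hstep1
    exact h
  -- STEP 3: independent rational Hodge classes spanning these spans; rational coordinates
  have hfin : ∀ jf : Fin (2 * Z.dim + 1), ∃ t : Set (complexBetti B.X (2 * p - jf)),
      t ⊆ R jf ∧ Submodule.span ℂ t = Submodule.span ℂ (R jf) ∧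
      LinearIndependent ℂ ((↑) : ↥t → complexBetti B.X (2 * p - jf)) ∧ t.Finite := by
    intro jf
    obtain ⟨t, ht, hspan, hli⟩ := exists_linearIndependent ℂ (R jf)
    exact ⟨t, ht, hspan, hli, hli.setFinite⟩
  choose t htR htspan htli htfin using hfin
  haveI : ∀ jf, Fintype ↥(t jf) := fun jf => (htfin jf).fintype
  have htQ : ∀ jf (e : ↥(t jf)), IsRationalClass (e : complexBetti B.X (2 * p - jf)) :=
    fun jf e => (htR jf e.2).1
  have hcoef : ∀ J, ∃ q : ↥(t J.1.1) → ℚ, a J = ∑ e, ((q e : ℚ) : ℂ) • (e : complexBetti B.X (2 * p - J.1.1)) := by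
    intro J
    have hmemJ : a J ∈ Submodule.span ℂ (Set.range ((↑) : ↥(t J.1.1) → complexBetti B.X (2 * p - J.1.1))) := by
      rw [Subtype.range_coe, htspan]
      exact haR J
    obtain ⟨cf, hcf⟩ := (Submodule.mem_span_range_iff_exists_fun ℂ).1 hmemJ
    have hrat : ∀ e, cf e ∈ Set.range (algebraMap ℚ ℂ) := fun e =>
      IsRationalClass.coeff_mem_range_of_linearIndependent (htQ J.1.1) (htli J.1.1) (c := cf)
        (by rw [hcf]; exact haQ J) e
    choose q hq using hrat
    refine ⟨q, ?_⟩
    rw [← hcf]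
    refine Finset.sum_congr rfl fun e _ => ?_
    rw [← hq e]
    rfl
  choose q hq using hcoef
  -- the rational classes `w` on the `Z`-side
  obtain ⟨w, hw⟩ : ∃ w : (jf : Fin (2 * Z.dim + 1)) → ((jf : ℕ) ≤ 2 * p) → ↥(t jf) → complexBetti Z.X jf,
      ∀ jf hjf e, w jf hjf e = ∑ i : Fin (rZ jf), ((q ⟨⟨jf, i⟩, hjf⟩ e : ℚ) : ℂ) • ζ jf i :=
    ⟨fun jf hjf e => ∑ i : Fin (rZ jf), ((q ⟨⟨jf, i⟩, hjf⟩ e : ℚ) : ℂ) • ζ jf i, fun _ _ _ => rfl⟩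
  have hwQ : ∀ jf hjf e, IsRationalClass (w jf hjf e) := fun jf hjf e => by
    rw [hw]
    exact IsRationalClass.sum_smul _ (hζ jf) _
  have hw_repr : ∀ jf hjf e i, (bZ jf).repr (w jf hjf e) i = ((q ⟨⟨jf, i⟩, hjf⟩ e : ℚ) : ℂ) := by
    intro jf hjf e i
    rw [hw]
    change (ζ jf).repr (∑ i' : Fin (rZ jf), ((q ⟨⟨jf, i'⟩, hjf⟩ e : ℚ) : ℂ) • ζ jf i') i = _
    rw [(ζ jf).repr_sum_self]
  -- the regrouped expansion `c = Σ_jf Σ_e pr_B^* e ⌣ pr_Z^* w_{jf,e}`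
  have hc_lh : c = ∑ J, cupProduct (Nat.sub_add_cancel J.2) (complexBetti.map (fst B.X Z.X) (2 * p - J.1.1) (a J))
      (complexBetti.map (snd B.X Z.X) J.1.1 (bZ J.1.1 J.1.2)) := by
    conv_lhs => rw [show c = E a from (E.apply_symm_apply c).symm, hE, LinearEquiv.ofBijective_apply,
      LerayHirsch.lhMap_eq_sum_idx]
  have hcw : c = ∑ jf : Fin (2 * Z.dim + 1), if hjf : (jf : ℕ) ≤ 2 * p then
      ∑ e : ↥(t jf), cupProduct (Nat.sub_add_cancel hjf) (complexBetti.map (fst B.X Z.X) (2 * p - jf)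
        (e : complexBetti B.X (2 * p - jf))) (complexBetti.map (snd B.X Z.X) jf (w jf hjf e)) else 0 := by
    rw [hc_lh, sum_idx_eq_sum_sum_dite]
    refine Finset.sum_congr rfl fun jf _ => ?_
    by_cases hjf : (jf : ℕ) ≤ 2 * p
    · simp only [dif_pos hjf]
      -- `Σ_i pr_B^* a_(jf,i) ⌣ pr_Z^* ζ_i = Σ_e pr_B^* e ⌣ pr_Z^* w_e`
      have h1 : ∀ i : Fin (rZ jf), cupProduct (Nat.sub_add_cancel hjf)
          (complexBetti.map (fst B.X Z.X) (2 * p - jf) (a ⟨⟨jf, i⟩, hjf⟩))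
          (complexBetti.map (snd B.X Z.X) jf (bZ jf i)) =
          ∑ e : ↥(t jf), cupProduct (Nat.sub_add_cancel hjf)
            (complexBetti.map (fst B.X Z.X) (2 * p - jf) (e : complexBetti B.X (2 * p - jf)))
            (complexBetti.map (snd B.X Z.X) jf (((q ⟨⟨jf, i⟩, hjf⟩ e : ℚ) : ℂ) • ζ jf i)) := by
        intro i
        rw [hq ⟨⟨jf, i⟩, hjf⟩, map_sum, LinearMap.map_sum₂]
        refine Finset.sum_congr rfl fun e _ => ?_
        rw [map_smul, LinearMap.map_smul₂, map_smul, LinearMap.map_smul]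
      simp only [h1]
      rw [Finset.sum_comm]
      refine Finset.sum_congr rfl fun e _ => ?_
      rw [hw, map_sum, map_sum]
    · simp only [dif_neg hjf]
      exact Finset.sum_eq_zero fun i _ => rfl
  -- the Hodge type of `e ∈ t jf`
  have hte : ∀ jf (e : ↥(t jf)), ∃ l, 2 * l = 2 * p - (jf : ℕ) ∧
      IsOfHodgeType B.dim B.X (2 * p - jf) l l (e : complexBetti B.X (2 * p - jf)) := fun jf e => (htR jf e.2).2
  choose lB hlB hlBtyp using hte
  -- STEP 4: `w_{jf,e}` is of type `(k,k)` — apply `π` and read Künneth coefficients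
  have hwproj : ∀ (jf : Fin (2 * Z.dim + 1)) (hjf : (jf : ℕ) ≤ 2 * p) (e : ↥(t jf))
      (hk : (p - lB jf e) + (p - lB jf e) = (jf : ℕ)),
      MZ.typeProj jf ⟨(p - lB jf e, p - lB jf e), Finset.HasAntidiagonal.mem_antidiagonal.2 hk⟩ (w jf hjf e) =
        w jf hjf e := by
    intro jf₀ hjf₀ e₀ hk₀
    -- `π c = Σ_jf Σ_e pr_B^* e ⌣ pr_Z^* π_Z w`
    have hπsum : c = ∑ jf : Fin (2 * Z.dim + 1), if hjf : (jf : ℕ) ≤ 2 * p then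
        ∑ e : ↥(t jf), cupProduct (Nat.sub_add_cancel hjf) (complexBetti.map (fst B.X Z.X) (2 * p - jf)
          (e : complexBetti B.X (2 * p - jf))) (complexBetti.map (snd B.X Z.X) jf
          (MZ.typeProj jf ⟨(p - lB jf e, p - lB jf e), Finset.HasAntidiagonal.mem_antidiagonal.2 (by
            have := hlB jf e; omega)⟩ (w jf hjf e))) else 0 := by
      conv_lhs => rw [← hπc, hcw]
      rw [map_sum]
      refine Finset.sum_congr rfl fun jf _ => ?_
      by_cases hjf : (jf : ℕ) ≤ 2 * p
      · simp only [dif_pos hjf, map_sum]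
        refine Finset.sum_congr rfl fun e _ => ?_
        exact typeProj_cupProduct_map_fst_map_snd hB hZ MX MZ (Nat.sub_add_cancel hjf)
          (by have := hlB jf e; omega) (hlBtyp jf e) (w jf hjf e) (by have := hlB jf e; omega) (by omega)
          (by have := hlB jf e; omega) (by have := hlB jf e; omega)
      · simp only [dif_neg hjf, map_zero]
    -- read the Künneth coefficient at `J₀ = (jf₀, i₀)` for every `i₀`
    have hcoefs : ∀ i₀ : Fin (rZ jf₀), ((q ⟨⟨jf₀, i₀⟩, hjf₀⟩ e₀ : ℚ) : ℂ) =
        (bZ jf₀).repr (MZ.typeProj jf₀ ⟨(p - lB jf₀ e₀, p - lB jf₀ e₀),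
          Finset.HasAntidiagonal.mem_antidiagonal.2 hk₀⟩ (w jf₀ hjf₀ e₀)) i₀ := by
      intro i₀
      set J₀ : LerayHirsch.Idx (fun J : (Σ j : Fin (2 * Z.dim + 1), Fin (rZ j)) ↦ (J.1 : ℕ)) (2 * p) :=
        ⟨⟨jf₀, i₀⟩, hjf₀⟩ with hJ₀
      -- `a J₀` computed from `hπsum`
      have hκ := congrArg (fun x => (E.symm x) J₀) hπsum
      simp only [map_sum, Finset.sum_apply] at hκ
      rw [Finset.sum_eq_single jf₀] at hκ
      · rw [dif_pos hjf₀, map_sum, Finset.sum_apply] at hκ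
        have hterm : ∀ e : ↥(t jf₀), (E.symm (cupProduct (Nat.sub_add_cancel hjf₀)
            (complexBetti.map (fst B.X Z.X) (2 * p - jf₀) (e : complexBetti B.X (2 * p - jf₀)))
            (complexBetti.map (snd B.X Z.X) jf₀ (MZ.typeProj jf₀ ⟨(p - lB jf₀ e, p - lB jf₀ e),
              Finset.HasAntidiagonal.mem_antidiagonal.2 (by have := hlB jf₀ e; omega)⟩ (w jf₀ hjf₀ e))))) J₀ =
            (bZ jf₀).repr (MZ.typeProj jf₀ ⟨(p - lB jf₀ e, p - lB jf₀ e),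
              Finset.HasAntidiagonal.mem_antidiagonal.2 (by have := hlB jf₀ e; omega)⟩ (w jf₀ hjf₀ e)) i₀ •
              (e : complexBetti B.X (2 * p - jf₀)) := fun e =>
          kunneth_symm_cupProduct_apply_self hB hZ bZ (2 * p) J₀ _ _
        simp only [hterm] at hκ
        -- compare with `a J₀ = Σ_e q e • e` through the independence of `t jf₀`
        change a J₀ = _ at hκ
        rw [hq J₀] at hκ
        have hdiff : ∑ e : ↥(t jf₀), (((q J₀ e : ℚ) : ℂ) -
            (bZ jf₀).repr (MZ.typeProj jf₀ ⟨(p - lB jf₀ e, p - lB jf₀ e),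
              Finset.HasAntidiagonal.mem_antidiagonal.2 (by have := hlB jf₀ e; omega)⟩ (w jf₀ hjf₀ e)) i₀) •
            (e : complexBetti B.X (2 * p - jf₀)) = 0 := by
          simp only [sub_smul, Finset.sum_sub_distrib]
          rw [← hκ, sub_self]
        have h0 := Fintype.linearIndependent_iff.1 (htli jf₀) _ hdiff e₀
        rw [sub_eq_zero] at h0
        exact h0
      · intro jf _ hne
        by_cases hjf : (jf : ℕ) ≤ 2 * p
        · rw [dif_pos hjf, map_sum, Finset.sum_apply]
          refine Finset.sum_eq_zero fun e _ => ?_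
          exact kunneth_symm_cupProduct_apply_of_ne hB hZ bZ (2 * p) J₀ hjf (Ne.symm hne) _ _
        · rw [dif_neg hjf, map_zero, Pi.zero_apply]
      · exact fun h => absurd (Finset.mem_univ _) h
    -- conclude `π_Z w = w` by comparing coordinates
    refine (bZ jf₀).ext_elem fun i₀ => ?_
    rw [← hcoefs i₀, hw_repr]
  -- STEP 5: assemble
  rw [hcw]
  refine Submodule.sum_mem _ fun jf _ => ?_
  by_cases hjf : (jf : ℕ) ≤ 2 * p
  · rw [dif_pos hjf]
    refine Submodule.sum_mem _ fun e _ => Submodule.subset_span ?_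
    have hl := hlB jf e
    have hk : (p - lB jf e) + (p - lB jf e) = (jf : ℕ) := by omega
    have hk2 : 2 * (p - lB jf e) = (jf : ℕ) := by omega
    have htypZ : IsOfHodgeType Z.dim Z.X jf (p - lB jf e) (p - lB jf e) (w jf hjf e) := by
      have hmemZ := MZ.typeProj_mem jf
        ⟨(p - lB jf e, p - lB jf e), Finset.HasAntidiagonal.mem_antidiagonal.2 hk⟩ (w jf hjf e)
      rw [hwproj jf hjf e hk] at hmemZ
      -- elaborate bottom-up (no expected type: the type pieces must not be unfolded by the unifier)
      have htypZ' := MZ.isOfHodgeType_of_mem_typePiece hmemZ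
      exact htypZ'
    exact cupProduct_mem_hodgeProductClasses B Z (Nat.sub_add_cancel hjf) hl hk2
      (htQ jf e) (hlBtyp jf e) (hwQ jf hjf e) htypZ
  · rw [dif_neg hjf]
    exact Submodule.zero_mem _

end Criterion

end Literature.AlgebraicGeometry.HodgeTheory

end
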